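import Literature.NumberTheory.Automorphic.UnitaryGroupBorelConstantTermInvariance
import Literature.NumberTheory.Automorphic.UnitaryGroupBorelCuspForms
import HarnessLib

/-!
# The Borel constant term, Arthur's truncation `Λ^T`, the truncated kernel `k^T` and `J^T(f)` on
# `U(J_N)` do not depend on the auxiliary Haar measure of `N(𝔸_F)` nor on the fundamental domain of
# `N(F)` used to realise `∫_{N(F)\N(𝔸_F)}`
(Rogawski, *Automorphic Representations of Unitary Groups in Three Variables* (1990), §2.1–§2.2;
Mœglin–Waldspurger, *Spectral decomposition and Eisenstein series* (1995), I.2.6)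

Topic `NumberTheory/Automorphic`; namespace `Literature.NumberTheory.Automorphic` (§1, generic) and
`Literature.NumberTheory.Automorphic.UnitaryGroup` (§§2–3). THEOREMS ONLY over Mathlib and accepted
tree modules: no definition, no named fact, no `sorry`, no instance, no notation.

The accepted T1-qs letters (`UnitaryGroupBorelTruncation`, `UnitaryGroupArthurTruncatedKernel`,
`UnitaryGroupArthurTruncatedTrace`) realise the integral over the compact quotient `N(F)\N(𝔸_F)` of
print as `ν(𝓕)⁻¹ ∫_𝓕 · dν` for a CHOSEN Haar measure `ν` of `N(𝔸_F)` and a CHOSEN fundamental domain `𝓕`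
of `N(F)`, and carry `(ν, 𝓕)` as parameters of `borelConstantTerm`, `constantTermTail`, `truncation`,
`kernelBorel`, `kernelBorelTail`, `truncatedKernel`, `truncatedTrace`, `truncatedTracePolynomial`,
`arthurTrace`; the named facts `TruncatedKernelIntegrable` / `TruncatedTracePolynomial` quantify over
all such `(ν, 𝓕)`. This file proves that NOTHING depends on the choice:

* §1 (generic). For a second countable locally compact group `G`, a countable subgroup `Γ` acting by
  left translation, Haar measures `μ, μ'` with fundamental domains `𝓕, 𝓕'`, and a `Γ`-invariant `f`:
  `μ(𝓕)⁻¹ ∫_𝓕 f dμ = μ'(𝓕')⁻¹ ∫_{𝓕'} f dμ'` (`smul_setIntegral_eq_of_isFundamentalDomain`): `μ' = κ μ`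
  by uniqueness of Haar measure (`κ > 0` cancels in the normalised average), and for one measure the
  integral of a `Γ`-invariant function and the measure do not depend on the fundamental domain
  (Mathlib `IsFundamentalDomain.setIntegral_eq` / `measure_eq`). No finiteness and no integrability
  hypothesis (junk values agree).
* §2 (`U(J_N)`, every `N`). `borelConstantTerm ν 𝓕 φ = borelConstantTerm ν' 𝓕' φ` for left
  `N(F)`-invariant `φ` (`borelConstantTerm_eq_of_isHaarMeasure`) — `φ_B(g) = ∫_{N(F)\N(𝔸_F)} φ(ng) dn`
  for THE invariant probability measure [Rogawski1990, §2.1; MoeglinWaldspurger1995, I.2.6] is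
  well defined (one-measure special case for `U(F)`-invariant `φ`: ★ `UnitaryGroupBorelCuspForms`);
  hence `IsBorelCuspidal`, `constantTermTail`, `truncation` for such `φ`; and, for EVERY `f` (the Borel
  sum `z ↦ Σ_{β ∈ B(F)} f(x⁻¹ β z)` being `B(F)`-invariant), `kernelBorel ν 𝓕 f = kernelBorel ν' 𝓕' f`,
  `kernelBorelTail`, `truncatedKernel`, `truncatedTrace μ ν 𝓕 T f = truncatedTrace μ ν' 𝓕' T f`,
  `IsTruncatedTracePolynomial`, `truncatedTracePolynomial`, `arthurTrace` — Arthur's `K_B`, `k^T`,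
  `J^T(f)`, its polynomial and `J(f)` [Rogawski1990, §2.2 pp. 12–13] depend only on `(μ, T, f)`.

## References

* J. D. Rogawski, *Automorphic Representations of Unitary Groups in Three Variables*, Annals of
  Mathematics Studies 123 (1990), §2.1 (p. 11: `φ_P(g) = ∫_{N(F)\𝐍} φ(ng) dn`), §2.2 (pp. 12–14:
  `K_P`, `k^T`, `J^T`) [Rogawski1990].
* C. Mœglin, J.-L. Waldspurger, *Spectral decomposition and Eisenstein series* (1995), I.2.6
  (constant terms; the measure on `N(k)\N(𝔸)` of total mass one) [MoeglinWaldspurger1995].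
-/

noncomputable section

open MeasureTheory Measure NumberField IsDedekindDomain Topology Set
open scoped NNReal ENNReal Pointwise

namespace Literature.NumberTheory.Automorphic

/-! ## §1 The normalised average over a fundamental domain is independent of the Haar measure and of
the fundamental domain -/

section Generic

variable {G : Type*} [Group G] [TopologicalSpace G] [IsTopologicalGroup G] [LocallyCompactSpace G]
  [SecondCountableTopology G] [MeasurableSpace G] [BorelSpace G]

/-- **The normalised average of a `Γ`-invariant function over a fundamental domain depends neither on
the Haar measure nor on the fundamental domain**: for Haar measures `μ, μ'` on a second countable
locally compact group, a countable subgroup `Γ` acting by left translation with fundamental domains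
`𝓕` (for `μ`) and `𝓕'` (for `μ'`), and `f` with `f(γ x) = f(x)` (`γ ∈ Γ`),
`μ(𝓕)⁻¹ ∫_𝓕 f dμ = μ'(𝓕')⁻¹ ∫_{𝓕'} f dμ'`. Proof: `μ' = κ • μ` with `0 < κ < ∞` (uniqueness of Haar
measure), `𝓕'` is then also a fundamental domain for `μ`, `μ(𝓕') = μ(𝓕)` and `∫_{𝓕'} f dμ = ∫_𝓕 f dμ`
(Mathlib `IsFundamentalDomain.measure_eq` / `setIntegral_eq`), and `κ` cancels. Both sides are the
junk value `0` when the fundamental domains have infinite measure. This is the well-definedness of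
`∫_{Γ\G} f` as an average, e.g. of the constant term `φ_P(g) = ∫_{N(F)\𝐍} φ(ng) dn` of Rogawski (1990),
§2.1, for the invariant probability measure. [cite: Rogawski1990, §2.1 (p. 11)] -/
theorem smul_setIntegral_eq_of_isFundamentalDomain (μ μ' : Measure G) [μ.IsHaarMeasure]
    [μ'.IsHaarMeasure] (Γ : Subgroup G) [Countable Γ] {𝓕 𝓕' : Set G}
    (h𝓕 : IsFundamentalDomain Γ 𝓕 μ) (h𝓕' : IsFundamentalDomain Γ 𝓕' μ')
    {V : Type*} [NormedAddCommGroup V] [NormedSpace ℝ V] {f : G → V}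
    (hf : ∀ γ ∈ Γ, ∀ x : G, f (γ * x) = f x) :
    ((μ 𝓕).toReal⁻¹ : ℝ) • ∫ x in 𝓕, f x ∂μ = ((μ' 𝓕').toReal⁻¹ : ℝ) • ∫ x in 𝓕', f x ∂μ' := by
  haveI : MeasurableConstSMul Γ G := ⟨fun γ => (continuous_const.mul continuous_id).measurable⟩
  haveI : SMulInvariantMeasure Γ G μ := ⟨fun γ s _hs => by
    rw [show (fun x : G => γ • x) ⁻¹' s = (fun x : G => (γ : G) * x) ⁻¹' s from rfl,
      measure_preimage_mul]⟩
  have hf' : ∀ (γ : Γ) (x : G), f (γ • x) = f x := fun γ x => hf γ γ.2 x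
  -- uniqueness of Haar measure: `μ' = κ • μ`, `κ ≠ 0`
  set κ := haarScalarFactor μ' μ with hκ
  have hμ' : μ' = κ • μ := isMulLeftInvariant_eq_smul μ' μ
  have hκ0 : κ ≠ 0 := (haarScalarFactor_pos_of_isHaarMeasure μ' μ).ne'
  -- `𝓕'` is a fundamental domain for `μ` as well
  have hac : μ ≪ μ' := by
    intro s hs
    rw [hμ', Measure.coe_nnreal_smul_apply, mul_eq_zero] at hs
    rcases hs with hs | hs
    · exact absurd (ENNReal.coe_eq_zero.1 hs) hκ0
    · exact hs
  have h𝓕'μ : IsFundamentalDomain Γ 𝓕' μ := h𝓕'.mono hac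
  -- compare
  have hm : μ' 𝓕' = κ * μ 𝓕 := by
    rw [hμ', Measure.coe_nnreal_smul_apply, h𝓕'μ.measure_eq h𝓕]
  have hI : ∫ x in 𝓕', f x ∂μ' = (κ : ℝ) • ∫ x in 𝓕, f x ∂μ := by
    rw [hμ', Measure.restrict_smul, integral_smul_nnreal_measure, h𝓕'μ.setIntegral_eq h𝓕 hf',
      NNReal.smul_def]
  rw [hm, hI, smul_smul, ENNReal.toReal_mul, ENNReal.coe_toReal, mul_inv, mul_comm ((κ : ℝ)⁻¹),
    mul_assoc, inv_mul_cancel₀ (NNReal.coe_ne_zero.2 hκ0), mul_one]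

end Generic

/-! ## §2 `U(J_N)`: independence of `(ν, 𝓕)` -/

namespace UnitaryGroup

variable {F E : Type} [Field F] [NumberField F] [Field E] [NumberField E] [Algebra F E]
  {c : E ≃ₐ[F] E} {N : ℕ}

omit [NumberField F] [Algebra F E] in
/-- `𝔸_E` is Hausdorff (local copy of the standard three-line argument). [folklore] -/
private theorem t2Space_adeleRing_E'' : T2Space (AdeleRing (𝓞 E) E) := by
  haveI : T2Space (FiniteAdeleRing (𝓞 E) E) := inferInstanceAs <| T2Space
    (RestrictedProduct (fun w : HeightOneSpectrum (𝓞 E) => w.adicCompletion E)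
      (fun w => (w.adicCompletionIntegers E : Set (w.adicCompletion E))) Filter.cofinite)
  haveI : T2Space (InfiniteAdeleRing E) :=
    inferInstanceAs <| T2Space ((w : InfinitePlace E) → w.Completion)
  exact inferInstanceAs <| T2Space (InfiniteAdeleRing E × FiniteAdeleRing (𝓞 E) E)

/-- `N(𝔸_F)` is a second countable locally compact group and `N(F)` is countable (private plumbing,
as in `UnitaryGroupBorelConstantTermInvariance`). [folklore] -/
private theorem topology_adelicUnipotent :
    LocallyCompactSpace (adelicUnipotent F E c N) ∧ SecondCountableTopology (adelicUnipotent F E c N) ∧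
      Countable (rationalUnipotent F E c N) := by
  haveI := secondCountableTopology_adeleRing E
  haveI := locallyCompactSpace_adeleRing' E
  haveI := t2Space_adeleRing_E'' (E := E)
  haveI : LocallyCompactSpace (quasiSplit F E c N).Adelic :=
    inferInstanceAs (LocallyCompactSpace (adelic F E c N ((StdForm.antidiagonal N).over E)))
  haveI : SecondCountableTopology (quasiSplit F E c N).Adelic :=
    inferInstanceAs (SecondCountableTopology (adelic F E c N ((StdForm.antidiagonal N).over E)))
  have hcl : IsClosed ((adelicUnipotent F E c N : Set (quasiSplit F E c N).Adelic)) := by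
    change IsClosed (⇑(adelicVal F E c N ((StdForm.antidiagonal N).over E)) ⁻¹'
      ((upperUnitriangular (Fin N) (AdeleRing (𝓞 E) E) : Subgroup (GL (Fin N) (AdeleRing (𝓞 E) E))) :
        Set (GL (Fin N) (AdeleRing (𝓞 E) E))))
    exact (isClosed_upperUnitriangular (R := AdeleRing (𝓞 E) E)).preimage continuous_subtype_val
  refine ⟨hcl.locallyCompactSpace, TopologicalSpace.Subtype.secondCountableTopology _, ?_⟩
  have hinj : Function.Injective fun γ : rationalUnipotent F E c N =>
      (⟨((γ : adelicUnipotent F E c N) : (quasiSplit F E c N).Adelic), γ.2⟩ :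
        (quasiSplit F E c N).arithmeticSubgroup) := by
    intro a a' h
    exact Subtype.ext (Subtype.ext (congrArg
      (fun z : (quasiSplit F E c N).arithmeticSubgroup => (z : (quasiSplit F E c N).Adelic)) h))
  haveI : Countable (quasiSplit F E c N).arithmeticSubgroup := by
    haveI : Countable E := NumberField.countable' (K := E)
    haveI : Countable (Matrix (Fin N) (Fin N) E) := inferInstanceAs (Countable (Fin N → Fin N → E))
    haveI : Countable (GL (Fin N) E) := Units.val_injective.countable
    haveI : Countable (quasiSplit F E c N).Rational :=
      inferInstanceAs (Countable (rational F E c N ((StdForm.antidiagonal N).over E)))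
    exact (Set.countable_range _).to_subtype
  exact hinj.countable

section Independence

variable [MeasurableSpace (adelicUnipotent F E c N)] [BorelSpace (adelicUnipotent F E c N)]

/-- **The Borel constant term does not depend on `(ν, 𝓕)`**: for Haar measures `ν, ν'` of `N(𝔸_F)`,
fundamental domains `𝓕` (for `ν`) and `𝓕'` (for `ν'`) of `N(F)`, and `φ` left `N(F)`-invariant,
`borelConstantTerm ν 𝓕 φ = borelConstantTerm ν' 𝓕' φ` — both are `g ↦ ∫_{N(F)\N(𝔸_F)} φ(ng) dn` for the
invariant probability measure (Rogawski (1990), §2.1; Mœglin–Waldspurger (1995), I.2.6). The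
one-measure case for left `U(F)`-invariant `φ` is ★ `borelConstantTerm_eq_of_isFundamentalDomain`
(`UnitaryGroupBorelCuspForms`), the rescaling formula ★ `borelConstantTerm_smul_measure`; here both
vary at once, only `N(F)`-invariance is asked, and no instance hypotheses remain.
[cite: Rogawski1990, §2.1 (p. 11)] -/
theorem borelConstantTerm_eq_of_isHaarMeasure (ν ν' : Measure (adelicUnipotent F E c N))
    [ν.IsHaarMeasure] [ν'.IsHaarMeasure] {𝓕 𝓕' : Set (adelicUnipotent F E c N)}
    (h𝓕 : IsFundamentalDomain (rationalUnipotent F E c N) 𝓕 ν)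
    (h𝓕' : IsFundamentalDomain (rationalUnipotent F E c N) 𝓕' ν')
    {φ : (quasiSplit F E c N).Adelic → ℂ}
    (hφ : ∀ u : adelicUnipotent F E c N, u ∈ rationalUnipotent F E c N →
      ∀ x : (quasiSplit F E c N).Adelic, φ ((u : (quasiSplit F E c N).Adelic) * x) = φ x) :
    borelConstantTerm ν 𝓕 φ = borelConstantTerm ν' 𝓕' φ := by
  obtain ⟨h1, h2, h3⟩ := topology_adelicUnipotent (F := F) (E := E) (c := c) (N := N)
  funext g
  rw [borelConstantTerm_def, borelConstantTerm_def]
  refine smul_setIntegral_eq_of_isFundamentalDomain ν ν' (rationalUnipotent F E c N) h𝓕 h𝓕'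
    (f := fun u : adelicUnipotent F E c N => φ ((u : (quasiSplit F E c N).Adelic) * g)) ?_
  intro γ hγ u
  change φ (((γ * u : adelicUnipotent F E c N) : (quasiSplit F E c N).Adelic) * g) =
    φ ((u : (quasiSplit F E c N).Adelic) * g)
  rw [Subgroup.coe_mul, mul_assoc]
  exact hφ γ hγ _

/-- The same for left `B(F)`-invariant `φ` (the hypothesis shape of the T1-qs letters; `N(F) ≤ B(F)`).
[cite: Rogawski1990, §2.1 (p. 11)] -/
theorem borelConstantTerm_eq_of_isHaarMeasure_of_borel (ν ν' : Measure (adelicUnipotent F E c N))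
    [ν.IsHaarMeasure] [ν'.IsHaarMeasure] {𝓕 𝓕' : Set (adelicUnipotent F E c N)}
    (h𝓕 : IsFundamentalDomain (rationalUnipotent F E c N) 𝓕 ν)
    (h𝓕' : IsFundamentalDomain (rationalUnipotent F E c N) 𝓕' ν')
    {φ : (quasiSplit F E c N).Adelic → ℂ}
    (hφ : ∀ b ∈ arithmeticBorel F E c N, ∀ x : (quasiSplit F E c N).Adelic,
      φ ((b : (quasiSplit F E c N).Adelic) * x) = φ x) :
    borelConstantTerm ν 𝓕 φ = borelConstantTerm ν' 𝓕' φ :=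
  borelConstantTerm_eq_of_isHaarMeasure ν ν' h𝓕 h𝓕' fun u hu x =>
    hφ ⟨(u : (quasiSplit F E c N).Adelic), hu⟩ (adelicUnipotent_le_borelAdelic u.2) x

/-- **Borel-cuspidality for fixed data does not depend on the data**: for left `N(F)`-invariant `φ`,
`IsBorelCuspidal ν 𝓕 φ ↔ IsBorelCuspidal ν' 𝓕' φ` for any two Haar measures and fundamental domains
(generalising ★ `isBorelCuspidal_iff_of_isFundamentalDomain` and ★ `IsBorelCuspidal.smul_measure` of
`UnitaryGroupBorelCuspForms`). [cite: Rogawski1990, §2.1 (pp. 11–12)] -/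
theorem isBorelCuspidal_iff_of_isHaarMeasure (ν ν' : Measure (adelicUnipotent F E c N))
    [ν.IsHaarMeasure] [ν'.IsHaarMeasure] {𝓕 𝓕' : Set (adelicUnipotent F E c N)}
    (h𝓕 : IsFundamentalDomain (rationalUnipotent F E c N) 𝓕 ν)
    (h𝓕' : IsFundamentalDomain (rationalUnipotent F E c N) 𝓕' ν')
    {φ : (quasiSplit F E c N).Adelic → ℂ}
    (hφ : ∀ u : adelicUnipotent F E c N, u ∈ rationalUnipotent F E c N →
      ∀ x : (quasiSplit F E c N).Adelic, φ ((u : (quasiSplit F E c N).Adelic) * x) = φ x) :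
    IsBorelCuspidal ν 𝓕 φ ↔ IsBorelCuspidal ν' 𝓕' φ := by
  simp only [isBorelCuspidal_iff, borelConstantTerm_eq_of_isHaarMeasure ν ν' h𝓕 h𝓕' hφ]

/-- **The Borel kernel `K_B` does not depend on `(ν, 𝓕)`**, for EVERY `f`: `K_B(x, ·)` is the Borel
constant term of the left `B(F)`-invariant `z ↦ Σ_{β ∈ B(F)} f(x⁻¹ β z)`
(★ `borelSum_rational_borel_mul_right`). [cite: Rogawski1990, §2.2 (p. 13)] -/
theorem kernelBorel_eq_of_isFundamentalDomain (ν ν' : Measure (adelicUnipotent F E c N))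
    [ν.IsHaarMeasure] [ν'.IsHaarMeasure] {𝓕 𝓕' : Set (adelicUnipotent F E c N)}
    (h𝓕 : IsFundamentalDomain (rationalUnipotent F E c N) 𝓕 ν)
    (h𝓕' : IsFundamentalDomain (rationalUnipotent F E c N) 𝓕' ν')
    (f : (quasiSplit F E c N).Adelic → ℂ) : kernelBorel ν 𝓕 f = kernelBorel ν' 𝓕' f := by
  funext x y
  rw [kernelBorel_def, kernelBorel_def,
    borelConstantTerm_eq_of_isHaarMeasure_of_borel ν ν' h𝓕 h𝓕'
      (fun b hb z => borelSum_rational_borel_mul_right f ⟨b, hb⟩ x z)]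

variable [NeZero N]

/-- **The tail `c_B^T φ` does not depend on `(ν, 𝓕)`** for left `N(F)`-invariant `φ`.
[cite: Garrett2018, §2.10 (PDF p. 119)] -/
theorem constantTermTail_eq_of_isFundamentalDomain (ν ν' : Measure (adelicUnipotent F E c N))
    [ν.IsHaarMeasure] [ν'.IsHaarMeasure] {𝓕 𝓕' : Set (adelicUnipotent F E c N)}
    (h𝓕 : IsFundamentalDomain (rationalUnipotent F E c N) 𝓕 ν)
    (h𝓕' : IsFundamentalDomain (rationalUnipotent F E c N) 𝓕' ν') (T : ℝ≥0)
    {φ : (quasiSplit F E c N).Adelic → ℂ}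
    (hφ : ∀ u : adelicUnipotent F E c N, u ∈ rationalUnipotent F E c N →
      ∀ x : (quasiSplit F E c N).Adelic, φ ((u : (quasiSplit F E c N).Adelic) * x) = φ x) :
    constantTermTail ν 𝓕 T φ = constantTermTail ν' 𝓕' T φ := by
  funext x
  by_cases hx : T < borelHeight x
  · rw [constantTermTail_of_lt _ hx, constantTermTail_of_lt _ hx,
      borelConstantTerm_eq_of_isHaarMeasure ν ν' h𝓕 h𝓕' hφ]
  · rw [constantTermTail_of_not_lt _ hx, constantTermTail_of_not_lt _ hx]

/-- **Arthur's truncation `Λ^T φ` does not depend on `(ν, 𝓕)`** for left `N(F)`-invariant `φ`.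
[cite: Garrett2018, §2.10 (PDF p. 119)] -/
theorem truncation_eq_of_isFundamentalDomain (ν ν' : Measure (adelicUnipotent F E c N))
    [ν.IsHaarMeasure] [ν'.IsHaarMeasure] {𝓕 𝓕' : Set (adelicUnipotent F E c N)}
    (h𝓕 : IsFundamentalDomain (rationalUnipotent F E c N) 𝓕 ν)
    (h𝓕' : IsFundamentalDomain (rationalUnipotent F E c N) 𝓕' ν') (T : ℝ≥0)
    {φ : (quasiSplit F E c N).Adelic → ℂ}
    (hφ : ∀ u : adelicUnipotent F E c N, u ∈ rationalUnipotent F E c N →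
      ∀ x : (quasiSplit F E c N).Adelic, φ ((u : (quasiSplit F E c N).Adelic) * x) = φ x) :
    truncation ν 𝓕 T φ = truncation ν' 𝓕' T φ := by
  funext g
  rw [truncation_def, truncation_def, constantTermTail_eq_of_isFundamentalDomain ν ν' h𝓕 h𝓕' T hφ]

/-- **The cut-off tail of `K_B` does not depend on `(ν, 𝓕)`**, for every `f`.
[cite: Rogawski1990, §2.2 (p. 13)] -/
theorem kernelBorelTail_eq_of_isFundamentalDomain (ν ν' : Measure (adelicUnipotent F E c N))
    [ν.IsHaarMeasure] [ν'.IsHaarMeasure] {𝓕 𝓕' : Set (adelicUnipotent F E c N)}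
    (h𝓕 : IsFundamentalDomain (rationalUnipotent F E c N) 𝓕 ν)
    (h𝓕' : IsFundamentalDomain (rationalUnipotent F E c N) 𝓕' ν') (T : ℝ≥0)
    (f : (quasiSplit F E c N).Adelic → ℂ) : kernelBorelTail ν 𝓕 T f = kernelBorelTail ν' 𝓕' T f := by
  funext y
  by_cases hy : T < borelHeight y
  · rw [kernelBorelTail_of_lt _ hy, kernelBorelTail_of_lt _ hy,
      kernelBorel_eq_of_isFundamentalDomain ν ν' h𝓕 h𝓕' f]
  · rw [kernelBorelTail_of_not_lt _ hy, kernelBorelTail_of_not_lt _ hy]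

/-- **Arthur's truncated kernel `k^T` does not depend on `(ν, 𝓕)`**, for every `f`, every `T`.
[cite: Rogawski1990, §2.2 (p. 13)] -/
theorem truncatedKernel_eq_of_isFundamentalDomain (ν ν' : Measure (adelicUnipotent F E c N))
    [ν.IsHaarMeasure] [ν'.IsHaarMeasure] {𝓕 𝓕' : Set (adelicUnipotent F E c N)}
    (h𝓕 : IsFundamentalDomain (rationalUnipotent F E c N) 𝓕 ν)
    (h𝓕' : IsFundamentalDomain (rationalUnipotent F E c N) 𝓕' ν') (T : ℝ≥0)
    (f : (quasiSplit F E c N).Adelic → ℂ) : truncatedKernel ν 𝓕 T f = truncatedKernel ν' 𝓕' T f := by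
  funext x
  rw [truncatedKernel_def, truncatedKernel_def, kernelBorelTail_eq_of_isFundamentalDomain ν ν' h𝓕 h𝓕' T f]

/-- **`J^T(f)` does not depend on `(ν, 𝓕)`**: `truncatedTrace μ ν 𝓕 T f = truncatedTrace μ ν' 𝓕' T f`
for every measure `μ` on the automorphic quotient, every `T` and every `f` (Rogawski (1990), §2.1
p. 12: `T_G(f) = ∫ k^T`). [cite: Rogawski1990, §2.1 (p. 12)] -/
theorem truncatedTrace_eq_of_isFundamentalDomain (μ : Measure (quasiSplit F E c N).automorphicQuotient)
    (ν ν' : Measure (adelicUnipotent F E c N)) [ν.IsHaarMeasure] [ν'.IsHaarMeasure]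
    {𝓕 𝓕' : Set (adelicUnipotent F E c N)}
    (h𝓕 : IsFundamentalDomain (rationalUnipotent F E c N) 𝓕 ν)
    (h𝓕' : IsFundamentalDomain (rationalUnipotent F E c N) 𝓕' ν') (T : ℝ≥0)
    (f : (quasiSplit F E c N).Adelic → ℂ) : truncatedTrace μ ν 𝓕 T f = truncatedTrace μ ν' 𝓕' T f := by
  rw [truncatedTrace_def, truncatedTrace_def, truncatedKernel_eq_of_isFundamentalDomain ν ν' h𝓕 h𝓕' T f]

/-- The predicate «`p` computes `J^T(f)` for large `T`» does not depend on `(ν, 𝓕)`.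
[cite: Shokranian1992, Thm. (5.7) and Rem. (5.8)] -/
theorem isTruncatedTracePolynomial_iff_of_isFundamentalDomain
    (μ : Measure (quasiSplit F E c N).automorphicQuotient)
    (ν ν' : Measure (adelicUnipotent F E c N)) [ν.IsHaarMeasure] [ν'.IsHaarMeasure]
    {𝓕 𝓕' : Set (adelicUnipotent F E c N)}
    (h𝓕 : IsFundamentalDomain (rationalUnipotent F E c N) 𝓕 ν)
    (h𝓕' : IsFundamentalDomain (rationalUnipotent F E c N) 𝓕' ν')
    (f : (quasiSplit F E c N).Adelic → ℂ) (p : Polynomial ℂ) :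
    IsTruncatedTracePolynomial μ ν 𝓕 f p ↔ IsTruncatedTracePolynomial μ ν' 𝓕' f p := by
  unfold IsTruncatedTracePolynomial
  simp only [truncatedTrace_eq_of_isFundamentalDomain μ ν ν' h𝓕 h𝓕']

/-- **Arthur's polynomial of `f` does not depend on `(ν, 𝓕)`.** [cite: Shokranian1992, Thm. (5.7) and Rem. (5.8)] -/
theorem truncatedTracePolynomial_eq_of_isFundamentalDomain
    (μ : Measure (quasiSplit F E c N).automorphicQuotient)
    (ν ν' : Measure (adelicUnipotent F E c N)) [ν.IsHaarMeasure] [ν'.IsHaarMeasure]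
    {𝓕 𝓕' : Set (adelicUnipotent F E c N)}
    (h𝓕 : IsFundamentalDomain (rationalUnipotent F E c N) 𝓕 ν)
    (h𝓕' : IsFundamentalDomain (rationalUnipotent F E c N) 𝓕' ν')
    (f : (quasiSplit F E c N).Adelic → ℂ) :
    truncatedTracePolynomial μ ν 𝓕 f = truncatedTracePolynomial μ ν' 𝓕' f := by
  by_cases h : ∃ p : Polynomial ℂ, IsTruncatedTracePolynomial μ ν 𝓕 f p
  · obtain ⟨p, hp⟩ := h
    rw [truncatedTracePolynomial_eq hp, truncatedTracePolynomial_eq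
      ((isTruncatedTracePolynomial_iff_of_isFundamentalDomain μ ν ν' h𝓕 h𝓕' f p).1 hp)]
  · have h' : ¬∃ p : Polynomial ℂ, IsTruncatedTracePolynomial μ ν' 𝓕' f p := fun ⟨p, hp⟩ =>
      h ⟨p, (isTruncatedTracePolynomial_iff_of_isFundamentalDomain μ ν ν' h𝓕 h𝓕' f p).2 hp⟩
    rw [truncatedTracePolynomial_of_not h, truncatedTracePolynomial_of_not h']

/-- **Arthur's `J(f)` does not depend on `(ν, 𝓕)`.** [cite: Shokranian1992, Thm. (5.7) and Rem. (5.8)] -/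
theorem arthurTrace_eq_of_isFundamentalDomain (μ : Measure (quasiSplit F E c N).automorphicQuotient)
    (ν ν' : Measure (adelicUnipotent F E c N)) [ν.IsHaarMeasure] [ν'.IsHaarMeasure]
    {𝓕 𝓕' : Set (adelicUnipotent F E c N)}
    (h𝓕 : IsFundamentalDomain (rationalUnipotent F E c N) 𝓕 ν)
    (h𝓕' : IsFundamentalDomain (rationalUnipotent F E c N) 𝓕' ν')
    (f : (quasiSplit F E c N).Adelic → ℂ) : arthurTrace μ ν 𝓕 f = arthurTrace μ ν' 𝓕' f := by
  rw [arthurTrace_def, arthurTrace_def, truncatedTracePolynomial_eq_of_isFundamentalDomain μ ν ν' h𝓕 h𝓕' f]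

end Independence

end UnitaryGroup

end Literature.NumberTheory.Automorphic
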